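import Literature.Combinatorics.StablePolynomials.BlockPolarization
import Literature.Combinatorics.StablePolynomials.BasicProofs
import HarnessLib

/-!
# Borcea–Brändén I, Theorem 1.1 for every number of variables and every degree bound `κ ≥ 1`

J. Borcea, P. Brändén, *The Lee–Yang and Pólya–Schur programs. I. Linear operators preserving stability*,
Invent. Math. 177 (2009) 541–569 (arXiv:0809.0401), §1.1:

> **Theorem 1.1.** Let `κ ∈ ℕⁿ` and `T : ℂ_κ[z_1,…,z_n] → ℂ[z_1,…,z_n]` be a linear operator. Then `T`
> preserves stability if and only if either
> (a) `T` has range of dimension at most one and is of the form `T(f) = α(f)P`, where `α` is a linear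
> functional on `ℂ_κ[z_1,…,z_n]` and `P` is a stable polynomial, or
> (b) `G_T(z,w) ∈ 𝓗_{2n}(ℂ)`.

Here `ℂ_κ[z_1,…,z_n]` is the space of polynomials of degree `≤ κ_i` in `z_i` and
`G_T(z,w) = T[(z+w)^κ] = Σ_{α ≤ κ} binom(κ,α) T(z^α)(z) w^{κ-α}` (§1.1). This file proves the theorem for every
finite set of variables `τ` and **every `κ` with `κ_i ≥ 1`** (`BorceaBranden_stabilityPreserver_iff`), via the
reduction of §2.2:

> "(c) … the proofs of Theorems 1.1–1.3 reduce to the case of multi-affine polynomials,"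

which is the tree's `multiAffine_stabilityPreserver_necessity` / `multiAffine_stabilityPreserver_sufficiency`
(`BasicProofs.lean`), together with the polarization `Π↑` along a fiber map `b : σ → τ`
(`BlockPolarization.lean`: `κ_i = |b⁻¹(i)|`, `Π↓ = rename b`, Prop. 2.4 and the block Grace–Walsh–Szegő
theorem). The case `κ_i = 0` for some `i` (variables on which the inputs do not depend) is not covered by this
reduction, which needs a section `s` of `b` (`b ∘ s = id`) to embed `ℂ[z_τ]` into `ℂ[z_σ]`.

## The reduction

With `L = ι ∘ T ∘ Π↓` (`fiberLift`, `ι = rename s`):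
* `T` preserves stability on `ℂ_κ[z_τ]` iff `L` preserves stability on multi-affine polynomials
  (`fiberLift_preserves`, `preserves_of_fiberLift`; uses `Π↓Π↑ = id`, Prop. 2.4, and
  `deg_{z_i} Π↓f ≤ κ_i` for multi-affine `f`, `degreeOf_rename_le_card_fiber`);
* `G_L(Z,W) = T[Π_v (z_{b(v)} + W_v)](Z ∘ s)` (`eval_multiAffineSymbol_fiberLift`); on block-constant points this
  is `G_T`, and for fixed `Z` the map `W ↦ G_L(Z,W)` is multi-affine and fiber-symmetric (`liftSymbolAt`), so
  by the block Grace–Walsh–Szegő theorem `G_L ∈ 𝓗(ℂ)` iff `G_T ∈ 𝓗(ℂ)`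
  (`isUpperHalfPlaneStable_multiAffineSymbol_fiberLift_iff`);
* the rank-one alternative transfers through `ι(T p) = L(Π↑ p)` (`exists_functional_of_fiberLift`).

## Contents

* §1 `fiberLift`, `degreeOf_rename_le_card_fiber`, `fiberLift_preserves`, `preserves_of_fiberLift`.
* §2 `prod_comp_fiber_eq`, `liftSymbolAt`, `eval_liftSymbolAt`, `isFiberSymmetric_liftSymbolAt`,
  `eval_multiAffineSymbol_fiberLift`, `isUpperHalfPlaneStable_multiAffineSymbol_fiberLift_iff`.
* §3 `exists_functional_of_fiberLift`, **`boundedDegree_stabilityPreserver_iff_fiber`**.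
* §4 `boundedDegreeSymbol κ T = G_T(z,w)`, `eval_boundedDegreeSymbol`, `card_fiber_sigma_fst`,
  **`BorceaBranden_stabilityPreserver_iff`** (Theorem 1.1, all `n`, all `κ ≥ 1`).

## References

* [BorceaBranden2009] J. Borcea, P. Brändén, Invent. Math. 177 (2009) 541–569, §1.1 Thm. 1.1, §2.2 (Π↑_κ, Π↓_κ,
  Prop. 2.4, "(c)"), §3 (the multi-affine case).
-/

noncomputable section

open MvPolynomial Finset

namespace Literature.Combinatorics.StablePolynomials

variable {σ τ : Type*} (b : σ → τ) (s : τ → σ)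

/-! ## §1 The lift `L = ι ∘ T ∘ Π↓` and the transfer of the preserver property -/

section Lift

/-- **The multi-affine lift `L = ι ∘ T ∘ Π↓`** of a linear operator `T` on `ℂ[z_τ]`: `Π↓ = rename b`,
`ι = rename s` for a section `s` of `b`. [cite: BorceaBranden2009, §2.2 ("(c) … reduce to the case of
multi-affine polynomials")] -/
def fiberLift (T : MvPolynomial τ ℂ →ₗ[ℂ] MvPolynomial τ ℂ) : MvPolynomial σ ℂ →ₗ[ℂ] MvPolynomial σ ℂ :=
  (rename s : MvPolynomial τ ℂ →ₐ[ℂ] MvPolynomial σ ℂ).toLinearMap ∘ₗ T ∘ₗ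
    (rename b : MvPolynomial σ ℂ →ₐ[ℂ] MvPolynomial τ ℂ).toLinearMap

/-- `L f = ι(T(Π↓ f))`. [cite: BorceaBranden2009, §2.2] -/
theorem fiberLift_apply (T : MvPolynomial τ ℂ →ₗ[ℂ] MvPolynomial τ ℂ) (f : MvPolynomial σ ℂ) :
    fiberLift b s T f = rename s (T (rename b f)) :=
  rfl

/-- **`ι = rename s` preserves and reflects stability** when `b ∘ s = id`: `ι(p)(z ∘ b) = p(z)` and
`ι(p)(Z) = p(Z ∘ s)`. [cite: BorceaBranden2009, §1 (definition of stability)] -/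
theorem isUpperHalfPlaneStable_rename_section_iff (hs : ∀ i, b (s i) = i) (p : MvPolynomial τ ℂ) :
    IsUpperHalfPlaneStable (rename s p) ↔ IsUpperHalfPlaneStable p := by
  constructor
  · intro h z hz
    have h' := h (z ∘ b) fun v => hz (b v)
    rwa [eval_rename, show (z ∘ b) ∘ s = z from funext fun i => by simp [hs i]] at h'
  · intro h Z hZ
    rw [eval_rename]
    exact h _ fun i => hZ (s i)

/-- `rename s` is injective for a section `s`. [folklore] -/
private theorem rename_section_injective (hs : ∀ i, b (s i) = i) :
    Function.Injective (rename s : MvPolynomial τ ℂ → MvPolynomial σ ℂ) :=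
  rename_injective s fun i j h => by rw [← hs i, ← hs j, h]

variable [Fintype σ] [DecidableEq τ]

/-- **`deg_{z_i} Π↓f ≤ κ_i`** for multi-affine `f`: `Π↓` maps `ℂ_{(1,…,1)}[z_σ]` into `ℂ_κ[z_τ]`, `κ_i = |b⁻¹(i)|`.
[cite: BorceaBranden2009, §2.2 (Π↓_κ : `𝕂_{(1^κ)}` → `𝕂_κ`)] -/
theorem degreeOf_rename_le_card_fiber {f : MvPolynomial σ ℂ} (hf : IsMultiAffine f) (i : τ) :
    degreeOf i (rename b f) ≤ (fiber b i).card := by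
  classical
  refine degreeOf_le_iff.2 fun m hm => ?_
  obtain ⟨u, hu, rfl⟩ : ∃ u ∈ f.support, Finsupp.mapDomain b u = m := by
    by_contra hne
    push Not at hne
    exact (mem_support_iff.1 hm)
      (coeff_rename_eq_zero b f m fun u hu' => notMem_support_iff.1 fun hmem => hne u hmem hu')
  rw [Finsupp.mapDomain, Finsupp.sum_apply]
  simp only [Finsupp.single_apply]
  calc (u.sum fun v n => if b v = i then n else 0)
      = ∑ v ∈ u.support, (if b v = i then u v else 0) := rfl
    _ ≤ ∑ v ∈ u.support, (if b v = i then 1 else 0) := sum_le_sum fun v _ => by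
        split_ifs
        · exact (monomial_le_degreeOf v hu).trans (hf v)
        · exact le_rfl
    _ = (u.support.filter fun v => b v = i).card := (card_filter _ _).symm
    _ ≤ (fiber b i).card := card_le_card fun v hv => (mem_fiber b).2 (mem_filter.1 hv).2

/-- **`T` preserves stability on `ℂ_κ[z_τ]` ⇒ `L` preserves stability on multi-affine polynomials.**
[cite: BorceaBranden2009, §2.2 ("(a) The linear operators `Π↑_κ` and `Π↓_κ` preserve stability")] -/
theorem fiberLift_preserves (hs : ∀ i, b (s i) = i) (T : MvPolynomial τ ℂ →ₗ[ℂ] MvPolynomial τ ℂ)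
    (hT : ∀ p : MvPolynomial τ ℂ, (∀ i, degreeOf i p ≤ (fiber b i).card) → IsUpperHalfPlaneStable p →
      IsUpperHalfPlaneStable (T p) ∨ T p = 0)
    {f : MvPolynomial σ ℂ} (hf : IsMultiAffine f) (hst : IsUpperHalfPlaneStable f) :
    IsUpperHalfPlaneStable (fiberLift b s T f) ∨ fiberLift b s T f = 0 := by
  rw [fiberLift_apply]
  rcases hT _ (degreeOf_rename_le_card_fiber b hf) (isUpperHalfPlaneStable_rename_fiberMap b hst) with h | h
  · exact Or.inl ((isUpperHalfPlaneStable_rename_section_iff b s hs _).2 h)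
  · exact Or.inr (by rw [h, map_zero])

variable [DecidableEq σ] [Fintype τ]

/-- **`L` preserves stability on multi-affine polynomials ⇒ `T` preserves stability on `ℂ_κ[z_τ]`**
(through `ι(T p) = L(Π↑ p)`, Prop. 2.4 and `Π↓Π↑ = id`). [cite: BorceaBranden2009, §2.2 Prop. 2.4 and "(b)
`Π↓_κ ∘ Π↑_κ = id`"] -/
theorem preserves_of_fiberLift (hs : ∀ i, b (s i) = i) (T : MvPolynomial τ ℂ →ₗ[ℂ] MvPolynomial τ ℂ)
    (hL : ∀ f : MvPolynomial σ ℂ, IsMultiAffine f → IsUpperHalfPlaneStable f →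
      IsUpperHalfPlaneStable (fiberLift b s T f) ∨ fiberLift b s T f = 0)
    {p : MvPolynomial τ ℂ} (hp : ∀ i, degreeOf i p ≤ (fiber b i).card) (hst : IsUpperHalfPlaneStable p) :
    IsUpperHalfPlaneStable (T p) ∨ T p = 0 := by
  have h := hL (fiberPolarization b p) (isMultiAffine_fiberPolarization b p)
    ((isUpperHalfPlaneStable_fiberPolarization_iff b hp).2 hst)
  rw [fiberLift_apply, rename_fiberPolarization b hp] at h
  rcases h with h | h
  · exact Or.inl ((isUpperHalfPlaneStable_rename_section_iff b s hs _).1 h)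
  · exact Or.inr (rename_section_injective b s hs (by rw [h, map_zero]))

end Lift

/-! ## §2 The symbol of `L` versus `G_T` -/

section Symbol

variable [Fintype σ] [DecidableEq σ] [Fintype τ] [DecidableEq τ]

omit [DecidableEq σ] in
/-- `Π_v f(b(v)) = Π_i f(i)^{κ_i}`: block-constant products. [cite: BorceaBranden2009, §2.2 (Π↓_κ sets
`z_{ij} = z_i`)] -/
theorem prod_comp_fiber_eq {M : Type*} [CommMonoid M] (f : τ → M) :
    ∏ v, f (b v) = ∏ i, f i ^ (fiber b i).card := by
  rw [← prod_fiberwise' univ b f]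
  refine prod_congr rfl fun i _ => ?_
  rw [prod_const]
  rfl

/-- **The `W`-slice of the symbol of `L`**: for fixed `z'`, the coefficient form
`Σ_S T[Π_{v ∉ S} z_{b(v)}](z') W^S` of `W ↦ T[Π_v (z_{b(v)} + W_v)](z')`. [cite: BorceaBranden2009, §2.2 and
§1.1 (`G_T(z,w) = Σ_S T(z^S)(z) w^{[n]∖S}` in the multi-affine case)] -/
def liftSymbolAt (T : MvPolynomial τ ℂ →ₗ[ℂ] MvPolynomial τ ℂ) (z' : τ → ℂ) : MvPolynomial σ ℂ :=
  multiAffine fun S : Finset σ => eval z' (T (∏ v ∈ Sᶜ, X (b v)))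

omit [DecidableEq σ] [Fintype τ] [DecidableEq τ] in
/-- `Π_v (X_{b v} + W_v) = Π_v (W_v + X_{b v})`. [folklore] -/
private theorem prod_X_comp_add_C (W : σ → ℂ) :
    (∏ v, (X (b v) + C (W v)) : MvPolynomial τ ℂ) = ∏ v, (C (W v) + X (b v)) :=
  prod_congr rfl fun _ _ => add_comm _ _

omit [Fintype τ] [DecidableEq τ] in
/-- **Evaluating the `W`-slice**: `liftSymbolAt b T z' (W) = T[Π_v (z_{b(v)} + W_v)](z')`.
[cite: BorceaBranden2009, §1.1 (G_T) and §2.2] -/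
theorem eval_liftSymbolAt (T : MvPolynomial τ ℂ →ₗ[ℂ] MvPolynomial τ ℂ) (z' : τ → ℂ) (W : σ → ℂ) :
    eval W (liftSymbolAt b T z') = eval z' (T (∏ v, (X (b v) + C (W v)))) := by
  rw [prod_X_comp_add_C, prod_add, map_sum, map_sum, liftSymbolAt, eval_multiAffine, powerset_univ]
  refine sum_congr rfl fun S _ => ?_
  rw [← compl_eq_univ_sdiff, ← map_prod C, ← smul_eq_C_mul, map_smul, smul_eval, mul_comm]

omit [Fintype τ] [DecidableEq τ] in
/-- **The `W`-slice is fiber-symmetric** (its coefficient at `W^S` depends only on the blocks met by `Sᶜ`).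
[cite: BorceaBranden2009, §2.2 ("symmetric in each group of variables")] -/
theorem isFiberSymmetric_liftSymbolAt (T : MvPolynomial τ ℂ →ₗ[ℂ] MvPolynomial τ ℂ) (z' : τ → ℂ) :
    IsFiberSymmetric b (liftSymbolAt b T z') := by
  intro e he
  simp only [liftSymbolAt, multiAffine, map_sum]
  refine sum_nbij' (fun S => S.map e.toEmbedding) (fun S => S.map e.symm.toEmbedding) (by simp) (by simp)
    (fun S _ => by ext x; simp) (fun S _ => by ext x; simp) fun S _ => ?_
  have hcompl : (S.map e.toEmbedding)ᶜ = Sᶜ.map e.toEmbedding := by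
    ext x
    simp only [mem_compl, mem_map_equiv]
  have hc : eval z' (T (∏ v ∈ (S.map e.toEmbedding)ᶜ, X (b v))) = eval z' (T (∏ v ∈ Sᶜ, X (b v))) := by
    rw [hcompl, prod_map]
    simp only [Equiv.coe_toEmbedding, he]
  rw [_root_.map_mul (rename (⇑e) : MvPolynomial σ ℂ →ₐ[ℂ] MvPolynomial σ ℂ), rename_C,
    _root_.map_prod (rename (⇑e) : MvPolynomial σ ℂ →ₐ[ℂ] MvPolynomial σ ℂ), prod_map, hc]
  simp only [rename_X, Equiv.coe_toEmbedding]

omit [Fintype τ] [DecidableEq τ] in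
/-- The `W`-slice is multi-affine. [cite: BorceaBranden2009, §2.2 ("multi-affine")] -/
theorem isMultiAffine_liftSymbolAt (T : MvPolynomial τ ℂ →ₗ[ℂ] MvPolynomial τ ℂ) (z' : τ → ℂ) :
    IsMultiAffine (liftSymbolAt b T z') := by
  unfold liftSymbolAt
  exact isMultiAffine_multiAffine _

omit [Fintype τ] [DecidableEq τ] in
/-- **`G_L(Z,W) = T[Π_v (z_{b(v)} + W_v)](Z ∘ s)`.** [cite: BorceaBranden2009, §1.1 (G_T) and §2.2] -/
theorem eval_multiAffineSymbol_fiberLift (T : MvPolynomial τ ℂ →ₗ[ℂ] MvPolynomial τ ℂ) (Z W : σ → ℂ) :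
    eval (Sum.elim Z W) (multiAffineSymbol (fiberLift b s T)) =
      eval (Z ∘ s) (T (∏ v, (X (b v) + C (W v)))) := by
  rw [eval_multiAffineSymbol, fiberLift_apply, eval_rename, map_prod]
  simp only [map_add, rename_X, rename_C]

/-- **`G_L ∈ 𝓗_{2|σ|}(ℂ)` iff `G_T ∈ 𝓗_{2|τ|}(ℂ)`**, where `G_T(z,w) = T[Π_i (z_i + w_i)^{κ_i}](z)`: "⇒" by block-constant
points, "⇐" by the block Grace–Walsh–Szegő theorem applied to the `W`-slice. [cite: BorceaBranden2009, §2.2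
Prop. 2.4 and "(c) proofs of Theorems 1.1–1.3 reduce to the case of multi-affine polynomials"] -/
theorem isUpperHalfPlaneStable_multiAffineSymbol_fiberLift_iff (hs : ∀ i, b (s i) = i)
    (T : MvPolynomial τ ℂ →ₗ[ℂ] MvPolynomial τ ℂ) :
    IsUpperHalfPlaneStable (multiAffineSymbol (fiberLift b s T)) ↔
      ∀ z w : τ → ℂ, (∀ i, 0 < (z i).im) → (∀ i, 0 < (w i).im) →
        eval z (T (∏ i, (X i + C (w i)) ^ (fiber b i).card)) ≠ 0 := by
  constructor
  · intro h z w hz hw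
    have h' := h (Sum.elim (z ∘ b) (w ∘ b)) (by rintro (v | v) <;> simp [hz, hw])
    rwa [eval_multiAffineSymbol_fiberLift, show (z ∘ b) ∘ s = z from funext fun i => by simp [hs i],
      show (∏ v, (X (b v) + C ((w ∘ b) v)) : MvPolynomial τ ℂ) = ∏ i, (X i + C (w i)) ^ (fiber b i).card from
        prod_comp_fiber_eq b fun i => (X i + C (w i) : MvPolynomial τ ℂ)] at h'
  · intro h ZW hZW
    rw [← Sum.elim_comp_inl_inr ZW, eval_multiAffineSymbol_fiberLift, ← eval_liftSymbolAt]
    obtain ⟨w, hw, hev⟩ := exists_eval_eq_eval_comp b (isMultiAffine_liftSymbolAt b T ((ZW ∘ Sum.inl) ∘ s))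
      (isFiberSymmetric_liftSymbolAt b T ((ZW ∘ Sum.inl) ∘ s)) (ZW ∘ Sum.inr) fun v => hZW (Sum.inr v)
    rw [hev, eval_liftSymbolAt,
      show (∏ v, (X (b v) + C ((w ∘ b) v)) : MvPolynomial τ ℂ) = ∏ i, (X i + C (w i)) ^ (fiber b i).card from
        prod_comp_fiber_eq b fun i => (X i + C (w i) : MvPolynomial τ ℂ)]
    exact h _ _ (fun i => hZW (Sum.inl (s i))) hw

end Symbol

/-! ## §3 Theorem 1.1 along a fiber map -/

section Main

variable [Fintype σ] [DecidableEq σ] [Fintype τ] [DecidableEq τ]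

omit [DecidableEq σ] in
/-- **The rank-one alternative transfers from `L` to `T`**: if `L f = α̃(f) P̃` on multi-affine `f` with `P̃`
stable, then `T p = α(p) P` on `ℂ_κ[z_τ]` with `P` stable (from `ι(T p) = L(Π↑ p)` and the injectivity of
`ι`). [cite: BorceaBranden2009, §1.1 Thm. 1.1 (a) and §2.2 "(b) `Π↓_κ ∘ Π↑_κ = id`"] -/
theorem exists_functional_of_fiberLift (hs : ∀ i, b (s i) = i) (T : MvPolynomial τ ℂ →ₗ[ℂ] MvPolynomial τ ℂ)
    {α : MvPolynomial σ ℂ →ₗ[ℂ] ℂ} {P : MvPolynomial σ ℂ} (hP : IsUpperHalfPlaneStable P)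
    (hαP : ∀ f : MvPolynomial σ ℂ, IsMultiAffine f → fiberLift b s T f = α f • P) :
    ∃ (β : MvPolynomial τ ℂ →ₗ[ℂ] ℂ) (Q : MvPolynomial τ ℂ), IsUpperHalfPlaneStable Q ∧
      ∀ p : MvPolynomial τ ℂ, (∀ i, degreeOf i p ≤ (fiber b i).card) → T p = β p • Q := by
  have key : ∀ p : MvPolynomial τ ℂ, (∀ i, degreeOf i p ≤ (fiber b i).card) →
      rename s (T p) = α (fiberPolarization b p) • P := fun p hp => by
    rw [← hαP _ (isMultiAffine_fiberPolarization b p), fiberLift_apply, rename_fiberPolarization b hp]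
  by_cases hzero : ∀ p : MvPolynomial τ ℂ, (∀ i, degreeOf i p ≤ (fiber b i).card) → T p = 0
  · refine ⟨0, C 1, isUpperHalfPlaneStable_C one_ne_zero, fun p hp => ?_⟩
    rw [hzero p hp, LinearMap.zero_apply, zero_smul]
  push Not at hzero
  obtain ⟨p₀, hp₀, hT0⟩ := hzero
  set c₀ : ℂ := α (fiberPolarization b p₀) with hc₀_def
  have hc₀ : c₀ ≠ 0 := fun h0 =>
    hT0 (rename_section_injective b s hs (by rw [key p₀ hp₀, ← hc₀_def, h0, zero_smul, map_zero]))
  have hQs : IsUpperHalfPlaneStable (T p₀) := by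
    rw [← isUpperHalfPlaneStable_rename_section_iff b s hs, key p₀ hp₀, smul_eq_C_mul]
    exact (isUpperHalfPlaneStable_C hc₀).mul hP
  refine ⟨c₀⁻¹ • (α ∘ₗ fiberPolarization b), T p₀, hQs, fun p hp => rename_section_injective b s hs ?_⟩
  rw [key p hp, map_smul, key p₀ hp₀, ← hc₀_def, smul_smul, LinearMap.smul_apply, LinearMap.comp_apply,
    smul_eq_mul, mul_comm _ c₀, ← mul_assoc, mul_inv_cancel₀ hc₀, one_mul]

/-- **Borcea–Brändén I, Theorem 1.1 along a fiber map** (`κ_i = |b⁻¹(i)| ≥ 1`, `s` a section of `b`): `T`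
maps stable polynomials of `ℂ_κ[z_τ]` to stable polynomials or `0` iff (a) `T = α(·)P` on `ℂ_κ[z_τ]` with `P`
stable, or (b) `G_T(z,w) = T[(z+w)^κ] ≠ 0` for `z, w ∈ ℋ^τ`. [cite: BorceaBranden2009, §1.1 Thm. 1.1 and
§§2.2, 3 (its proof via the multi-affine case)] -/
theorem boundedDegree_stabilityPreserver_iff_fiber (hs : ∀ i, b (s i) = i)
    (T : MvPolynomial τ ℂ →ₗ[ℂ] MvPolynomial τ ℂ) :
    (∀ p : MvPolynomial τ ℂ, (∀ i, degreeOf i p ≤ (fiber b i).card) → IsUpperHalfPlaneStable p →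
        IsUpperHalfPlaneStable (T p) ∨ T p = 0) ↔
      ((∃ (α : MvPolynomial τ ℂ →ₗ[ℂ] ℂ) (P : MvPolynomial τ ℂ), IsUpperHalfPlaneStable P ∧
          ∀ p : MvPolynomial τ ℂ, (∀ i, degreeOf i p ≤ (fiber b i).card) → T p = α p • P) ∨
        ∀ z w : τ → ℂ, (∀ i, 0 < (z i).im) → (∀ i, 0 < (w i).im) →
          eval z (T (∏ i, (X i + C (w i)) ^ (fiber b i).card)) ≠ 0) := by
  rw [← isUpperHalfPlaneStable_multiAffineSymbol_fiberLift_iff b s hs]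
  constructor
  · intro hT
    rcases multiAffine_stabilityPreserver_necessity (fiberLift b s T)
        (fun f hf hst => fiberLift_preserves b s hs T hT hf hst) with ⟨α, P, hP, hαP⟩ | hG
    · exact Or.inl (exists_functional_of_fiberLift b s hs T hP hαP)
    · exact Or.inr hG
  · rintro (⟨α, P, hP, hαP⟩ | hG) p hp hst
    · rw [hαP p hp]
      by_cases h : α p = 0
      · exact Or.inr (by rw [h, zero_smul])
      · exact Or.inl (by rw [smul_eq_C_mul]; exact (isUpperHalfPlaneStable_C h).mul hP)
    · exact preserves_of_fiberLift b s hs T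
        (fun f hf hst' => multiAffine_stabilityPreserver_sufficiency (fiberLift b s T) hG hf hst') hp hst

end Main

/-! ## §4 Theorem 1.1 for `κ : τ → ℕ`, `κ_i ≥ 1` -/

section Kappa

variable [Fintype τ] [DecidableEq τ]

/-- **The symbol `G_T(z,w) = T[(z+w)^κ] = Σ_{α ≤ κ} binom(κ,α) T(z^α)(z) w^{κ-α} ∈ ℂ[z_τ, w_τ]`** (variables
`τ ⊕ τ`, `Sum.inl` = `z`, `Sum.inr` = `w`). [cite: BorceaBranden2009, §1.1 ("`G_T(z,w) = T[(z+w)^κ] =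
Σ_{α≤κ} binom(κ,α) T(z^α) w^{κ-α}`")] -/
def boundedDegreeSymbol (κ : τ → ℕ) (T : MvPolynomial τ ℂ →ₗ[ℂ] MvPolynomial τ ℂ) : MvPolynomial (τ ⊕ τ) ℂ :=
  ∑ α ∈ Fintype.piFinset fun i => range (κ i + 1),
    (∏ i, (((κ i).choose (α i) : ℕ) : ℂ)) •
      (rename Sum.inl (T (∏ i, X i ^ α i)) * ∏ i, X (Sum.inr i) ^ (κ i - α i))

/-- `(z+w)^κ = Σ_{α ≤ κ} (Π_i binom(κ_i,α_i) w_i^{κ_i-α_i}) z^α` and linearity of `T`.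
[cite: BorceaBranden2009, §1.1 ("by linearity")] -/
theorem apply_prod_X_add_C_pow (κ : τ → ℕ) (T : MvPolynomial τ ℂ →ₗ[ℂ] MvPolynomial τ ℂ) (w : τ → ℂ) :
    T (∏ i, (X i + C (w i)) ^ κ i) =
      ∑ α ∈ Fintype.piFinset fun i => range (κ i + 1),
        (∏ i, (((κ i).choose (α i) : ℕ) : ℂ) * w i ^ (κ i - α i)) • T (∏ i, X i ^ α i) := by
  have h : (∏ i, (X i + C (w i)) ^ κ i : MvPolynomial τ ℂ) =
      ∑ α ∈ Fintype.piFinset fun i => range (κ i + 1),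
        (∏ i, (((κ i).choose (α i) : ℕ) : ℂ) * w i ^ (κ i - α i)) • ∏ i, X i ^ α i := by
    simp only [add_pow]
    rw [prod_univ_sum]
    refine sum_congr rfl fun α _ => ?_
    rw [smul_eq_C_mul, _root_.map_prod C, ← prod_mul_distrib]
    refine prod_congr rfl fun i _ => ?_
    rw [← C_pow, map_mul, map_natCast]
    ring
  rw [h, map_sum]
  simp only [map_smul]

/-- **`G_T(z,w) = T[Π_i (z_i + w_i)^{κ_i}](z)`** pointwise. [cite: BorceaBranden2009, §1.1 (definition of `G_T`)] -/
theorem eval_boundedDegreeSymbol (κ : τ → ℕ) (T : MvPolynomial τ ℂ →ₗ[ℂ] MvPolynomial τ ℂ) (z w : τ → ℂ) :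
    eval (Sum.elim z w) (boundedDegreeSymbol κ T) = eval z (T (∏ i, (X i + C (w i)) ^ κ i)) := by
  rw [apply_prod_X_add_C_pow, map_sum, boundedDegreeSymbol, map_sum]
  refine sum_congr rfl fun α _ => ?_
  rw [smul_eval, smul_eval, _root_.map_mul (eval (Sum.elim z w)), eval_rename,
    _root_.map_prod (eval (Sum.elim z w)), Sum.elim_comp_inl]
  simp only [map_pow, eval_X, Sum.elim_inr]
  rw [prod_mul_distrib]
  ring

/-- **`G_T ∈ 𝓗_{2n}(ℂ)` iff `T[Π_i (z_i + w_i)^{κ_i}](z) ≠ 0` for `z, w ∈ ℋ^τ`.** [cite: BorceaBranden2009, §1.1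
Thm. 1.1 (b)] -/
theorem isUpperHalfPlaneStable_boundedDegreeSymbol_iff (κ : τ → ℕ) (T : MvPolynomial τ ℂ →ₗ[ℂ] MvPolynomial τ ℂ) :
    IsUpperHalfPlaneStable (boundedDegreeSymbol κ T) ↔
      ∀ z w : τ → ℂ, (∀ i, 0 < (z i).im) → (∀ i, 0 < (w i).im) →
        eval z (T (∏ i, (X i + C (w i)) ^ κ i)) ≠ 0 := by
  constructor
  · intro h z w hz hw
    have h' := h (Sum.elim z w) (by rintro (i | i) <;> simp [hz, hw])
    rwa [eval_boundedDegreeSymbol] at h'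
  · intro h zw hzw
    rw [← Sum.elim_comp_inl_inr zw, eval_boundedDegreeSymbol]
    exact h _ _ (fun i => hzw (Sum.inl i)) fun i => hzw (Sum.inr i)

/-- The fibers of `Sigma.fst : (Σ i, Fin (κ i)) → τ` have cardinalities `κ_i`.
[cite: BorceaBranden2009, §2.2 ("new variables `z_{ij}`, `1 ≤ j ≤ κ_i`")] -/
theorem card_fiber_sigma_fst (κ : τ → ℕ) (i : τ) :
    (fiber (Sigma.fst : (Σ j, Fin (κ j)) → τ) i).card = κ i := by
  have h : fiber (Sigma.fst : (Σ j, Fin (κ j)) → τ) i =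
      univ.map ⟨Sigma.mk i, sigma_mk_injective⟩ := by
    ext ⟨j, l⟩
    simp only [mem_fiber, mem_map, mem_univ, true_and, Function.Embedding.coeFn_mk]
    constructor
    · rintro rfl
      exact ⟨l, rfl⟩
    · rintro ⟨l', h⟩
      exact (congrArg Sigma.fst h).symm
  rw [h, card_map, card_univ, Fintype.card_fin]

/-- **Borcea–Brändén I, Theorem 1.1 (every number of variables, every `κ` with `κ_i ≥ 1`).** A linear operator
`T` on `ℂ[z_τ]` maps every stable polynomial of `ℂ_κ[z_τ]` (degree `≤ κ_i` in `z_i`) to a stable polynomial or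
to `0` if and only if either (a) `T(p) = α(p)P` on `ℂ_κ[z_τ]` for a linear functional `α` and a stable `P`, or
(b) `G_T(z,w) = T[(z+w)^κ] ∈ 𝓗_{2n}(ℂ)`. [cite: BorceaBranden2009, §1.1 Thm. 1.1] -/
theorem BorceaBranden_stabilityPreserver_iff {κ : τ → ℕ} (hκ : ∀ i, 0 < κ i)
    (T : MvPolynomial τ ℂ →ₗ[ℂ] MvPolynomial τ ℂ) :
    (∀ p : MvPolynomial τ ℂ, (∀ i, degreeOf i p ≤ κ i) → IsUpperHalfPlaneStable p →
        IsUpperHalfPlaneStable (T p) ∨ T p = 0) ↔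
      ((∃ (α : MvPolynomial τ ℂ →ₗ[ℂ] ℂ) (P : MvPolynomial τ ℂ), IsUpperHalfPlaneStable P ∧
          ∀ p : MvPolynomial τ ℂ, (∀ i, degreeOf i p ≤ κ i) → T p = α p • P) ∨
        IsUpperHalfPlaneStable (boundedDegreeSymbol κ T)) := by
  have h := boundedDegree_stabilityPreserver_iff_fiber (Sigma.fst : (Σ j, Fin (κ j)) → τ)
    (fun i => ⟨i, ⟨0, hκ i⟩⟩) (fun _ => rfl) T
  simp only [card_fiber_sigma_fst] at h
  rw [h, isUpperHalfPlaneStable_boundedDegreeSymbol_iff]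

end Kappa

end Literature.Combinatorics.StablePolynomials

end
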